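import Literature.Probability.LatticeModels.LatticeSineGordon
import Summits.QuantumFields.YangMills.Theorems.SmallCircleAnchorAnchorGapStubDebyeScreening

/-!
# Crux `AnchorGap` (stmt-QuantumFields-11141), line `registered` — how the charge hypotheses of stub DS′ enter

Stub DS′ (`stub_debyeScreening`) of the skeleton `Cruxes/AnchorGap/Lines/birth.lean` assumes that
the charge family `α : Fin M → ℝᵏ` of the lattice sine-Gordon gas is SPANNING
(`∀ v, (∀ r, α_r · v = 0) → v = 0`) and COMMENSURATE (the dual set
`Λ* = {w | ∀ r, α_r · w ∈ 2πℤ}` contains `k` linearly independent vectors `b_j`).  This file proves,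
in closed elementary form, the three consequences through which these hypotheses enter any proof
of Debye screening:

* `debyeForm_pos` — **the Debye–Hückel mass form is non-degenerate**: spanning gives `a > 0` with
  `a |v|² ≤ Σ_r (α_r · v)²` for all `v` (the quadratic approximation of the tilt
  `2ζ Σ_r cos(α_r · φ)` is `2ζM − ζ Σ_r (α_r · φ)²`, so every field component acquires Debye mass²
  `≥ 2ζ g² a`); compactness of the unit sphere and homogeneity;
* `dualLattice_gap` — **`Λ*` is uniformly discrete**: a non-zero `w ∈ Λ*` has `|α_r · w| ≥ 2π` for
  some charge `r` (spanning), hence `(2π)² ≤ |α_r|² |w|²` (Cauchy–Schwarz): the sectors of the zero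
  mode are `2π / max_r |α_r|` apart;
* `dualLattice_cocompact` — **`Λ*` is cocompact**: with the commensurating basis `b`, every
  `θ ∈ ℝᵏ` is within sup-distance `R = Σ_j Σ_a |b_j a|` of the dual vector
  `w = Σ_j round(c_j) b_j ∈ Λ*` (`θ = Σ_j c_j b_j` in the basis `b`; `|c − round c| ≤ ½`), i.e. the
  compactified zero mode `ℝᵏ/Λ*` is a genuine torus with a bounded fundamental domain.
-/

set_option autoImplicit false

noncomputable section

namespace Summit.QuantumFields.YangMills.Theorems.AnchorGap

open MeasureTheory
open Literature.Probability.LatticeModels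

/-- **The Debye–Hückel form of a spanning charge family is positive definite**: if the only
vector orthogonal to every charge `α_r` is `0`, there is `a > 0` with `a Σ_i v_i² ≤ Σ_r (α_r · v)²`
for all `v` — the continuous form `q(v) = Σ_r (α_r · v)²` attains a minimum on the compact unit sphere
`{Σ v_i² = 1}`, which is positive by spanning, and `q(v/t) = q(v)/t²`. [folklore] -/
theorem debyeForm_pos :
    ∀ (k M : ℕ) (α : Fin M → Fin k → ℝ), (∀ v : Fin k → ℝ, (∀ r : Fin M, ∑ a : Fin k, α r a * v a = 0) → v = 0) → ∃ a : ℝ, 0 < a ∧ ∀ v : Fin k → ℝ, a * ∑ i : Fin k, v i ^ 2 ≤ ∑ r : Fin M, (∑ i : Fin k, α r i * v i) ^ 2 := by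
  intro k M α hspan
  set q : (Fin k → ℝ) → ℝ := fun v => ∑ r : Fin M, (∑ i : Fin k, α r i * v i) ^ 2 with hqdef
  set S : Set (Fin k → ℝ) := {v | ∑ i : Fin k, v i ^ 2 = 1} with hSdef
  have hq : Continuous q := by rw [hqdef]; fun_prop
  have hqnn : ∀ v, 0 ≤ q v := fun v => Finset.sum_nonneg fun r _ => sq_nonneg _
  have hqscale : ∀ (v : Fin k → ℝ) (t : ℝ), q (fun i => v i / t) = q v / t ^ 2 := by
    intro v t
    simp only [hqdef, Finset.sum_div]
    refine Finset.sum_congr rfl fun r _ => ?_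
    rw [← div_pow, Finset.sum_div]
    congr 1
    exact Finset.sum_congr rfl fun i _ => (mul_div_assoc _ _ _).symm
  have hS : IsCompact S := by
    refine Metric.isCompact_of_isClosed_isBounded (isClosed_eq (by fun_prop) continuous_const) ?_
    refine (Metric.isBounded_iff_subset_closedBall 0).2 ⟨1, fun v hv => ?_⟩
    rw [mem_closedBall_zero_iff, pi_norm_le_iff_of_nonneg zero_le_one]
    intro i
    have hv' : ∑ j : Fin k, v j ^ 2 = 1 := hv
    have : v i ^ 2 ≤ 1 := hv' ▸ Finset.single_le_sum (fun j _ => sq_nonneg (v j)) (Finset.mem_univ i)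
    rw [Real.norm_eq_abs]
    exact (sq_le_one_iff_abs_le_one _).1 this
  by_cases hne : S.Nonempty
  · obtain ⟨v₀, hv₀, hmin⟩ := hS.exists_isMinOn hne hq.continuousOn
    have hv₀' : ∑ j : Fin k, v₀ j ^ 2 = 1 := hv₀
    have hpos : 0 < q v₀ := by
      refine lt_of_le_of_ne (hqnn v₀) fun h => ?_
      have hz : ∀ r : Fin M, ∑ i : Fin k, α r i * v₀ i = 0 := fun r => by
        have := (Finset.sum_eq_zero_iff_of_nonneg fun r _ => sq_nonneg _).1 h.symm r (Finset.mem_univ r)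
        exact (pow_eq_zero_iff two_ne_zero).1 this
      have h0 := hspan v₀ hz
      rw [h0] at hv₀'
      simp at hv₀'
    refine ⟨q v₀, hpos, fun v => ?_⟩
    by_cases hv : ∑ i : Fin k, v i ^ 2 = 0
    · rw [hv, mul_zero]; exact hqnn v
    · have hvpos : 0 < ∑ i : Fin k, v i ^ 2 :=
        lt_of_le_of_ne (Finset.sum_nonneg fun i _ => sq_nonneg _) (Ne.symm hv)
      set t := Real.sqrt (∑ i : Fin k, v i ^ 2) with htdef
      have ht : 0 < t := Real.sqrt_pos.2 hvpos
      have htt : t ^ 2 = ∑ i : Fin k, v i ^ 2 := Real.sq_sqrt hvpos.le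
      have hu : (fun i => v i / t) ∈ S := by
        show ∑ i : Fin k, (v i / t) ^ 2 = 1
        simp_rw [div_pow]
        rw [← Finset.sum_div, ← htt, div_self (pow_ne_zero 2 ht.ne')]
      have hle : q v₀ ≤ q v / t ^ 2 := by rw [← hqscale]; exact hmin hu
      rw [← htt]
      calc q v₀ * t ^ 2 ≤ q v / t ^ 2 * t ^ 2 := mul_le_mul_of_nonneg_right hle (sq_nonneg _)
        _ = q v := div_mul_cancel₀ _ (pow_ne_zero 2 ht.ne')
  · -- no unit vectors: every `v` has `Σ v² = 0`
    refine ⟨1, one_pos, fun v => ?_⟩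
    by_cases hv : ∑ i : Fin k, v i ^ 2 = 0
    · rw [hv, mul_zero]; exact hqnn v
    · exfalso
      have hvpos : 0 < ∑ i : Fin k, v i ^ 2 :=
        lt_of_le_of_ne (Finset.sum_nonneg fun i _ => sq_nonneg _) (Ne.symm hv)
      set t := Real.sqrt (∑ i : Fin k, v i ^ 2) with htdef
      have ht : 0 < t := Real.sqrt_pos.2 hvpos
      have htt : t ^ 2 = ∑ i : Fin k, v i ^ 2 := Real.sq_sqrt hvpos.le
      refine hne ⟨fun i => v i / t, ?_⟩
      show ∑ i : Fin k, (v i / t) ^ 2 = 1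
      simp_rw [div_pow]
      rw [← Finset.sum_div, ← htt, div_self (pow_ne_zero 2 ht.ne')]

/-- **The dual lattice of a spanning charge family is uniformly discrete**: if `w ≠ 0` satisfies
`α_r · w ∈ 2πℤ` for all `r`, then some charge has `|α_r · w| ≥ 2π` (by spanning some `α_r · w ≠ 0`,
and a non-zero element of `2πℤ` has modulus `≥ 2π`), and then `(2π)² ≤ (Σ_a α_r a²)(Σ_a w_a²)` by
the Cauchy–Schwarz inequality. [folklore] -/
theorem dualLattice_gap :
    ∀ (k M : ℕ) (α : Fin M → Fin k → ℝ), (∀ v : Fin k → ℝ, (∀ r : Fin M, ∑ a : Fin k, α r a * v a = 0) → v = 0) → ∀ w : Fin k → ℝ, (∀ r : Fin M, ∃ z : ℤ, ∑ a : Fin k, α r a * w a = 2 * Real.pi * z) → w ≠ 0 → ∃ r : Fin M, 2 * Real.pi ≤ |∑ a : Fin k, α r a * w a| ∧ (2 * Real.pi) ^ 2 ≤ (∑ a : Fin k, α r a ^ 2) * ∑ a : Fin k, w a ^ 2 := by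
  intro k M α hspan w hw hw0
  have hex : ∃ r : Fin M, ∑ a : Fin k, α r a * w a ≠ 0 := by
    by_contra h
    push Not at h
    exact hw0 (hspan w h)
  obtain ⟨r, hr⟩ := hex
  obtain ⟨z, hz⟩ := hw r
  have hz0 : z ≠ 0 := by
    rintro rfl
    rw [Int.cast_zero, mul_zero] at hz
    exact hr hz
  have h1 : (1 : ℝ) ≤ |(z : ℝ)| := by
    rw [← Int.cast_abs]
    exact_mod_cast Int.one_le_abs hz0
  have hge : 2 * Real.pi ≤ |∑ a : Fin k, α r a * w a| := by
    rw [hz, abs_mul, abs_of_pos Real.two_pi_pos]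
    nlinarith [Real.two_pi_pos]
  refine ⟨r, hge, ?_⟩
  calc (2 * Real.pi) ^ 2 ≤ (∑ a : Fin k, α r a * w a) ^ 2 := by
        rw [← sq_abs (∑ a : Fin k, α r a * w a)]
        exact pow_le_pow_left₀ Real.two_pi_pos.le hge 2
    _ ≤ (∑ a : Fin k, α r a ^ 2) * ∑ a : Fin k, w a ^ 2 := Finset.sum_mul_sq_le_sq_mul_sq _ _ _

/-- **The dual lattice of a commensurate charge family is cocompact**: if `b : Fin k → ℝᵏ` is
linearly independent with `α_r · b_j ∈ 2πℤ` for all `j, r`, then every `θ ∈ ℝᵏ` lies within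
sup-distance `R = Σ_j Σ_a |b_j a|` of some `w` with `α_r · w ∈ 2πℤ` for all `r`: expand
`θ = Σ_j c_j b_j` in the basis `b` (`basisOfLinearIndependentOfCardEqFinrank`) and take
`w = Σ_j round(c_j) b_j`, using `|c − round c| ≤ ½`. [folklore] -/
theorem dualLattice_cocompact :
    ∀ (k M : ℕ) (α : Fin M → Fin k → ℝ) (b : Fin k → Fin k → ℝ), LinearIndependent ℝ b → (∀ (j : Fin k) (r : Fin M), ∃ z : ℤ, ∑ a : Fin k, α r a * b j a = 2 * Real.pi * z) → ∃ R : ℝ, ∀ θ : Fin k → ℝ, ∃ w : Fin k → ℝ, (∀ r : Fin M, ∃ z : ℤ, ∑ a : Fin k, α r a * w a = 2 * Real.pi * z) ∧ ∀ a : Fin k, |θ a - w a| ≤ R := by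
  intro k M α b hb hcomm
  choose z hz using hcomm
  rcases isEmpty_or_nonempty (Fin k) with hk | hk
  · refine ⟨0, fun θ => ⟨θ, fun r => ⟨0, by simp⟩, fun a => isEmptyElim a⟩⟩
  have hcard : Fintype.card (Fin k) = Module.finrank ℝ (Fin k → ℝ) := by simp
  set B := basisOfLinearIndependentOfCardEqFinrank hb hcard with hBdef
  have hB : ∀ j, B j = b j := fun j => by rw [hBdef, coe_basisOfLinearIndependentOfCardEqFinrank]
  refine ⟨∑ j : Fin k, ∑ a : Fin k, |b j a|, fun θ => ?_⟩
  set c : Fin k → ℝ := fun j => B.repr θ j with hcdef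
  have hθ : θ = ∑ j : Fin k, c j • b j := by
    conv_lhs => rw [← B.sum_repr θ]
    exact Finset.sum_congr rfl fun j _ => by rw [hB]
  refine ⟨∑ j : Fin k, (round (c j) : ℝ) • b j, fun r => ⟨∑ j : Fin k, round (c j) * z j r, ?_⟩, fun a => ?_⟩
  · -- `α_r · w = Σ_j round(c_j) (α_r · b_j) = 2π Σ_j round(c_j) z_{jr}`
    have : ∀ a : Fin k, (∑ j : Fin k, (round (c j) : ℝ) • b j) a = ∑ j : Fin k, (round (c j) : ℝ) * b j a := by
      intro a; simp [Finset.sum_apply, Pi.smul_apply, smul_eq_mul]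
    simp_rw [this, Finset.mul_sum]
    rw [Finset.sum_comm]
    push_cast
    rw [Finset.mul_sum]
    refine Finset.sum_congr rfl fun j _ => ?_
    have : ∑ a : Fin k, α r a * ((round (c j) : ℝ) * b j a) = (round (c j) : ℝ) * ∑ a : Fin k, α r a * b j a := by
      rw [Finset.mul_sum]; exact Finset.sum_congr rfl fun a _ => by ring
    rw [this, hz j r]
    ring
  · have h1 : θ a - (∑ j : Fin k, (round (c j) : ℝ) • b j) a = ∑ j : Fin k, (c j - round (c j)) * b j a := by
      rw [hθ]
      simp only [Finset.sum_apply, Pi.smul_apply, smul_eq_mul, ← Finset.sum_sub_distrib]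
      exact Finset.sum_congr rfl fun j _ => by ring
    rw [h1]
    calc |∑ j : Fin k, (c j - round (c j)) * b j a| ≤ ∑ j : Fin k, |(c j - round (c j)) * b j a| :=
          Finset.abs_sum_le_sum_abs _ _
      _ ≤ ∑ j : Fin k, |b j a| := Finset.sum_le_sum fun j _ => by
          rw [abs_mul]
          have := abs_sub_round (c j)
          nlinarith [abs_nonneg (b j a)]
      _ ≤ ∑ j : Fin k, ∑ a' : Fin k, |b j a'| := Finset.sum_le_sum fun j _ =>
          Finset.single_le_sum (fun a' _ => abs_nonneg (b j a')) (Finset.mem_univ a)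

end Summit.QuantumFields.YangMills.Theorems.AnchorGap

end
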